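import Literature.NumberTheory.LFunctions.WeilExplicitRightEdge
import Literature.NumberTheory.LFunctions.WeilArchimedeanPositivityProofs
import Literature.Analysis.SpecialFunctions.DigammaLogBound
import Mathlib.MeasureTheory.Measure.Lebesgue.Integral
import HarnessLib

/-!
# Carathéodory ⟹ unit slack, part I: deformed tests and the right edge

Sub-problem `RiemannHypothesis`, route `SignCone`, crux `ConeMagnification` (stmt-RiemannHypothesis-16303),
seat 0, session 7.  Support file for `unitSlack_of_cara` (the converse of the landed `stub_cara`): the
unit-slack cone of fake von Mangoldt weights IS the Carathéodory class.

This file: the exponentially damped test `e^{-δu} k(u)` (a test: `isWeilTest_expDamp`), its transform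
`(e^{-δ·}k)^(s) = k̂(s − δ)` (`weilMellin_expDamp`), the value of the symmetrised autocorrelation
`S = G + G(−·)`, `G = g ⋆ g̃`, on the critical line — the NONNEGATIVE weight
`|ĝ(1/2+iy)|² + |ĝ(1/2−iy)|²` (`weilMellin_weilSymm_autocorr_half`), which is also the value of the damped
test on the shifted line `Re s = 1/2 + δ` (`weilMellin_expDamp_line`) — the right edge of the contour for
GENERAL coefficients: `∫ L_a(σ+iy) k̂(σ+iy) dy = 2π Σ a(n) n^{-1/2} k(log n)` whenever
`Σ |a(n)| n^{-σ} < ∞` (`integral_LSeries_mul_weilMellin_vertical`, Mellin inversion term by term, Bombieri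
2000 §2 (2.2) with `Λ ↦ a`), the pole integral `∫ k̂(s)/(s−1)` read on BOTH sides of the pole
(`integral_weilMellin_vertical_div_sub_of_lt`, `…_sub_sub`: the two readings differ by `2π k̂(1)`), and the
archimedean integral against the symmetrised test (`integral_reDigamma_mul_weilMellin_weilSymm`).

References: E. Bombieri, Rend. Lincei (9) 11 (2000) §2; this route's `StubCara` file (forward direction).
-/

noncomputable section

-- `Summit.RiemannHypothesis.RiemannHypothesis.…` repeats a namespace component by design (D-0017 layout).
set_option linter.dupNamespace false

open Complex Filter Set MeasureTheory LSeries Literature.NumberTheory.LFunctions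
open scoped Real Topology ComplexConjugate

namespace Summit.RiemannHypothesis.RiemannHypothesis.Theorems.SignConeConeMagnification

variable {g k : ℝ → ℂ}

/-! ### Exponentially damped tests -/

/-! The damped test is written `fun u => cexp (-(δ * u)) * k u` throughout (no auxiliary definition). -/

/-- Damped tests are tests. [folklore] -/
theorem isWeilTest_expDamp (hk : IsWeilTest k) (δ : ℝ) :
    IsWeilTest fun u : ℝ => cexp (-((δ : ℂ) * u)) * k u := by
  refine ⟨?_, hk.2.mul_left⟩
  have h1 : ContDiff ℝ (⊤ : ℕ∞) fun u : ℝ => cexp (-((δ : ℂ) * u)) :=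
    ((contDiff_const.mul Complex.ofRealCLM.contDiff).neg).cexp
  exact h1.mul hk.1

/-- **Transform of a damped test**: `(e^{-δ·} k)^(s) = k̂(s − δ)`. [folklore] -/
theorem weilMellin_expDamp (δ : ℝ) (k : ℝ → ℂ) (s : ℂ) :
    weilMellin (fun u : ℝ => cexp (-((δ : ℂ) * u)) * k u) s = weilMellin k (s - δ) := by
  unfold weilMellin
  congr 1 with u
  simp only []
  rw [mul_comm (cexp _) (k u), mul_assoc, ← Complex.exp_add]
  congr 2
  ring

/-- At a node: `e^{-δ log n} = n^{-δ}` (real), so `(e^{-δ·}k)(log n) = n^{-δ} k(log n)` for `n ≥ 1`.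
[folklore] -/
theorem expDamp_log_nat (δ : ℝ) (k : ℝ → ℂ) {n : ℕ} (hn : n ≠ 0) :
    cexp (-((δ : ℂ) * (Real.log n : ℝ))) * k (Real.log n) = (((n : ℝ) ^ (-δ) : ℝ) : ℂ) * k (Real.log n) := by
  congr 1
  have hn0 : (0 : ℝ) < n := by exact_mod_cast Nat.pos_of_ne_zero hn
  rw [Real.rpow_def_of_pos hn0, Complex.ofReal_exp]
  congr 1
  push_cast
  ring

/-! ### The right edge for general coefficients -/

/-- **Right edge, general coefficients** (Bombieri (2.2) with `Λ ↦ a`): if `Σ |a(n)| n^{-σ} < ∞` then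
`∫ L_a(σ+iy) k̂(σ+iy) dy = 2π Σₙ a(n) n^{-1/2} k(log n)` for every test function `k`
(Mellin inversion `integral_weilMellin_vertical_mul_natCast_cpow` term by term; the interchange by
`Σ |a(n)| n^{-σ} ∫|k̂| < ∞`). [cite: Bombieri2000Weil, §2 eq. (2.2)] -/
theorem integral_LSeries_mul_weilMellin_vertical (hk : IsWeilTest k) {a : ℕ → ℂ} {σ : ℝ}
    (ha : LSeriesSummable a σ) :
    ∫ y : ℝ, LSeries a ((σ : ℂ) + y * I) * weilMellin k ((σ : ℂ) + y * I) =
      2 * π * ∑' n : ℕ, a n / (Real.sqrt n : ℂ) * k (Real.log n) := by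
  set F : ℕ → ℝ → ℂ := fun n y ↦ weilMellin k (σ + y * I) * term a (σ + y * I) n with hF
  have hFint : ∀ n, Integrable (F n) := fun n ↦
    integrable_weilMellin_vertical_mul hk σ (continuous_term_vertical _ σ n)
      (B := ‖term a (σ : ℂ) n‖) fun y ↦ (norm_term_vertical _ σ y n).le
  have hnorm : ∀ n, (∫ y : ℝ, ‖F n y‖) = (∫ y : ℝ, ‖weilMellin k (σ + y * I)‖) * ‖term a (σ : ℂ) n‖ := by
    intro n
    rw [← integral_mul_const]
    congr 1 with y
    rw [hF, norm_mul, norm_term_vertical]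
  have hsum : Summable fun n ↦ ∫ y : ℝ, ‖F n y‖ := by
    simp_rw [hnorm]
    exact Summable.mul_left _ (summable_norm_iff.mpr ha)
  have hswap := integral_tsum_of_summable_integral_norm hFint hsum
  have hterm : ∀ n : ℕ, (∫ y : ℝ, F n y) = 2 * π * (a n / (Real.sqrt n : ℂ) * k (Real.log n)) := by
    intro n
    rcases eq_or_ne n 0 with rfl | hn
    · simp [hF, term_zero]
    have e : F n = fun y : ℝ ↦ a n * (weilMellin k (σ + y * I) * (n : ℂ) ^ (-((σ : ℂ) + y * I))) := by
      funext y
      simp only [hF, term_of_ne_zero hn, cpow_neg, div_eq_mul_inv]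
      ring
    rw [e, integral_const_mul, integral_weilMellin_vertical_mul_natCast_cpow hk σ hn]
    ring
  calc ∫ y : ℝ, LSeries a ((σ : ℂ) + y * I) * weilMellin k (σ + y * I)
      = ∫ y : ℝ, ∑' n : ℕ, F n y := by
        congr 1 with y
        rw [hF, LSeries, mul_comm, ← tsum_mul_left]
    _ = ∑' n : ℕ, ∫ y : ℝ, F n y := hswap.symm
    _ = ∑' n : ℕ, 2 * π * (a n / (Real.sqrt n : ℂ) * k (Real.log n)) := tsum_congr hterm
    _ = 2 * π * ∑' n : ℕ, a n / (Real.sqrt n : ℂ) * k (Real.log n) := by rw [tsum_mul_left]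

/-! ### The pole part, read on both sides of `Re s = Re a` -/

/-- **Pole integral left of the pole**: for `c < Re a`,
`∫ k̂(c+iy)/(c+iy−a) dy = −2π ∫_{x ≤ 0} k(x) e^{(a−1/2)x} dx` (reflect `k`, `y ↦ −y`, and the right-of-pole
formula `integral_weilMellin_vertical_div_sub`). [folklore] -/
theorem integral_weilMellin_vertical_div_sub_of_lt (hk : IsWeilTest k) {c : ℝ} {a : ℂ}
    (hca : c < a.re) :
    ∫ y : ℝ, weilMellin k (c + y * I) / (c + y * I - a) =
      -(2 * π * ∫ x in Iic (0 : ℝ), k x * cexp ((a - 1 / 2) * x)) := by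
  have hk' : IsWeilTest (fun t => k (-t)) := hk.comp_neg
  have h := integral_weilMellin_vertical_div_sub hk' (c := 1 - c) (a := 1 - a) (by simp; linarith)
  set g : ℝ → ℂ := fun y => weilMellin (fun t => k (-t)) (((1 - c : ℝ) : ℂ) + y * I) /
    (((1 - c : ℝ) : ℂ) + y * I - (1 - a)) with hg
  have e1 : ∀ y : ℝ, weilMellin k (c + y * I) / (c + y * I - a) = -g (-y) := by
    intro y
    simp only [hg, weilMellin_comp_neg]
    have e2 : 1 - (((1 - c : ℝ) : ℂ) + ((-y : ℝ) : ℂ) * I) = c + y * I := by push_cast; ring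
    have e3 : ((1 - c : ℝ) : ℂ) + ((-y : ℝ) : ℂ) * I - (1 - a) = -(c + y * I - a) := by
      push_cast; ring
    rw [e2, e3, div_neg, neg_neg]
  simp_rw [e1]
  rw [integral_neg, integral_neg_eq_self g volume]
  simp only [hg]
  rw [h]
  congr 2
  have e4 : (fun x : ℝ => k (-x) * cexp ((1 - a - 1 / 2) * x)) =
      fun x : ℝ => (fun u : ℝ => k u * cexp ((a - 1 / 2) * u)) (-x) := by
    funext x
    simp only [ofReal_neg]
    congr 2
    ring
  rw [e4, integral_comp_neg_Ioi 0 (fun u : ℝ => k u * cexp ((a - 1 / 2) * u)), neg_zero]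

/-- **The two readings of the pole differ by the residue**: for `c₁ < Re a < c₂`,
`∫ k̂(c₂+iy)/(c₂+iy−a) dy − ∫ k̂(c₁+iy)/(c₁+iy−a) dy = 2π k̂(a)`. [folklore] -/
theorem integral_weilMellin_vertical_div_sub_sub (hk : IsWeilTest k) {c₁ c₂ : ℝ} {a : ℂ}
    (h₁ : c₁ < a.re) (h₂ : a.re < c₂) :
    (∫ y : ℝ, weilMellin k (c₂ + y * I) / (c₂ + y * I - a)) -
      ∫ y : ℝ, weilMellin k (c₁ + y * I) / (c₁ + y * I - a) = 2 * π * weilMellin k a := by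
  rw [integral_weilMellin_vertical_div_sub hk h₂, integral_weilMellin_vertical_div_sub_of_lt hk h₁,
    sub_neg_eq_add, ← mul_add, add_comm]
  congr 1
  have hint : Integrable fun x : ℝ => k x * cexp ((a - 1 / 2) * x) :=
    (hk.1.continuous.mul (by fun_prop)).integrable_of_hasCompactSupport hk.2.mul_right
  rw [intervalIntegral.integral_Iic_add_Ioi hint.integrableOn hint.integrableOn]
  rfl

/-! ### The symmetrised autocorrelation on the critical line -/

/-- **The weight on the critical line**: for `S = G + G(−·)`, `G = g ⋆ g̃`,
`Ŝ(1/2 + iy) = |ĝ(1/2+iy)|² + |ĝ(1/2−iy)|²` (real and nonnegative). [folklore] -/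
theorem weilMellin_weilSymm_autocorr_half (hg : IsWeilTest g) (y : ℝ) :
    weilMellin (weilSymm (weilConv g (weilReflect g))) (1 / 2 + y * I) =
      ((‖weilMellin g (1 / 2 + y * I)‖ ^ 2 + ‖weilMellin g (1 / 2 + ((-y : ℝ) : ℂ) * I)‖ ^ 2 : ℝ) : ℂ) := by
  have hG : IsWeilTest (weilConv g (weilReflect g)) := hg.weilConv hg.weilReflect
  rw [weilMellin_weilSymm hG]
  have e : 1 - (1 / 2 + (y : ℂ) * I) = 1 / 2 + ((-y : ℝ) : ℂ) * I := by push_cast; ring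
  rw [e, weilMellin_weilConv_weilReflect_half hg, weilMellin_weilConv_weilReflect_half hg]
  push_cast
  ring

/-- The damped test on the shifted line: `(e^{-δ·} k)^(1/2 + δ + iy) = k̂(1/2 + iy)`. [folklore] -/
theorem weilMellin_expDamp_line (δ : ℝ) (k : ℝ → ℂ) (y : ℝ) :
    weilMellin (fun u : ℝ => cexp (-((δ : ℂ) * u)) * k u) (((1 / 2 + δ : ℝ) : ℂ) + y * I) =
      weilMellin k (1 / 2 + y * I) := by
  rw [weilMellin_expDamp]
  congr 1
  push_cast
  ring

/-- `Ŝ(1) = Ĝ(0) + Ĝ(1)` is the polar term of `G`, for `S = G + G(−·)`. [folklore] -/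
theorem weilMellin_weilSymm_one {G : ℝ → ℂ} (hG : IsWeilTest G) :
    weilMellin (weilSymm G) 1 = weilPolarTerm G := by
  rw [weilMellin_weilSymm hG, sub_self, weilPolarTerm, add_comm]

/-- `∫ Ŝ(1/2 + iy) dy = 4π G(0)` for `S = G + G(−·)`. [folklore] -/
theorem integral_weilMellin_weilSymm_half {G : ℝ → ℂ} (hG : IsWeilTest G) :
    ∫ y : ℝ, weilMellin (weilSymm G) (1 / 2 + y * I) = 4 * π * G 0 := by
  have h := integral_weilMellin_vertical hG.weilSymm (1 / 2)
  have e : ((1 / 2 : ℝ) : ℂ) = 1 / 2 := by push_cast; ring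
  rw [e] at h
  rw [h, weilSymm_zero]
  ring

/-! ### The archimedean integral against the symmetrised test -/

/-- `Re ψ(1/4 + iy/2)` is even in `y` (`ψ(w̄) = conj ψ(w)`). [folklore] -/
theorem re_digamma_quarter_neg (y : ℝ) :
    (digamma (1 / 4 + ((-y : ℝ) : ℂ) / 2 * I)).re = (digamma (1 / 4 + y / 2 * I)).re := by
  have e : (1 / 4 : ℂ) + ((-y : ℝ) : ℂ) / 2 * I = conj (1 / 4 + y / 2 * I) := by
    simp only [map_add, map_div₀, map_one, map_ofNat, map_mul, conj_ofReal, conj_I]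
    push_cast
    ring
  rw [e, digamma_conj, conj_re]

/-- Integrability of `y ↦ Re ψ(1/4 + iy/2) · ĥ(1/2 + iy)` for a test function `h`. [folklore] -/
theorem integrable_reDigamma_mul_weilMellin_half {h : ℝ → ℂ} (hh : IsWeilTest h) :
    Integrable fun y : ℝ => ((digamma (1 / 4 + y / 2 * I)).re : ℂ) * weilMellin h (1 / 2 + y * I) := by
  obtain ⟨C, hC⟩ :=
    Literature.Analysis.SpecialFunctions.Complex.exists_norm_digamma_vertical_le (a := 1 / 4) (by norm_num)
  have hcont : Continuous fun y : ℝ => ((digamma (1 / 4 + y / 2 * I)).re : ℂ) := by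
    refine continuous_ofReal.comp (continuous_re.comp ?_)
    refine Literature.Analysis.SpecialFunctions.Complex.continuousOn_digamma.comp_continuous
      (by fun_prop) fun y => ?_
    simp only [mem_setOf_eq, add_re, div_ofNat_re, one_re, mul_re, ofReal_re, I_re, mul_zero,
      I_im, mul_one]
    norm_num
  have h := integrable_mul_weilMellin_vertical_of_norm_le_log hh (1 / 2) hcont (C := |C|) fun y => by
    rw [norm_real, Real.norm_eq_abs]
    refine (abs_re_le_norm _).trans ?_
    have e : (1 / 4 : ℂ) + (y : ℂ) / 2 * I = ((1 / 4 : ℝ) : ℂ) + ((y / 2 : ℝ) : ℂ) * I := by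
      push_cast; ring
    rw [e]
    refine (hC (y / 2)).trans ?_
    have : Real.log (1 + |y / 2|) ≤ Real.log (1 + |y|) := by
      refine Real.log_le_log (by positivity) ?_
      rw [abs_div, abs_two]
      linarith [abs_nonneg y]
    linarith [le_abs_self C]
  have e : ((1 / 2 : ℝ) : ℂ) = 1 / 2 := by push_cast; ring
  simpa only [e] using h

/-- **The archimedean integral against `S = G + G(−·)`**:
`∫ Re ψ(1/4 + iy/2) Ŝ(1/2 + iy) dy = 2 ∫ Ĝ(1/2 + it) Re ψ(1/4 + it/2) dt = 2 · weilArchIntegral G`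
(`Ŝ(1/2+iy) = Ĝ(1/2+iy) + Ĝ(1/2−iy)`, `y ↦ −y`, evenness of `Re ψ(1/4 + iy/2)`). [folklore] -/
theorem integral_reDigamma_mul_weilMellin_weilSymm {G : ℝ → ℂ} (hG : IsWeilTest G) :
    ∫ y : ℝ, ((digamma (1 / 4 + y / 2 * I)).re : ℂ) * weilMellin (weilSymm G) (1 / 2 + y * I) =
      2 * weilArchIntegral G := by
  set A : ℝ → ℂ := fun y => ((digamma (1 / 4 + y / 2 * I)).re : ℂ) * weilMellin G (1 / 2 + y * I)
    with hA
  have hAi : Integrable A := integrable_reDigamma_mul_weilMellin_half hG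
  have hsplit : (fun y : ℝ => ((digamma (1 / 4 + y / 2 * I)).re : ℂ) *
      weilMellin (weilSymm G) (1 / 2 + y * I)) = fun y : ℝ => A y + A (-y) := by
    funext y
    rw [weilMellin_weilSymm hG]
    have e : 1 - (1 / 2 + (y : ℂ) * I) = 1 / 2 + ((-y : ℝ) : ℂ) * I := by push_cast; ring
    simp only [hA, e, re_digamma_quarter_neg]
    ring
  rw [hsplit, integral_add hAi hAi.comp_neg, integral_neg_eq_self A volume, ← two_mul]
  congr 1
  unfold weilArchIntegral
  exact integral_congr_ae (Eventually.of_forall fun y => by simp only [hA]; ring)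

/-- **Anchor (registered sub-goal `caraPoleResidue` of stmt-RiemannHypothesis-16303)**: binder-free restatement of
`integral_weilMellin_vertical_div_sub_sub`. [folklore] -/
theorem caraPoleResidue :
    ∀ k : ℝ → ℂ, IsWeilTest k → ∀ c₁ c₂ : ℝ, ∀ a : ℂ, c₁ < a.re → a.re < c₂ →
      (∫ y : ℝ, weilMellin k (c₂ + y * Complex.I) / (c₂ + y * Complex.I - a)) -
        ∫ y : ℝ, weilMellin k (c₁ + y * Complex.I) / (c₁ + y * Complex.I - a) = 2 * Real.pi * weilMellin k a :=
  fun _ hk _ _ _ h₁ h₂ => integral_weilMellin_vertical_div_sub_sub hk h₁ h₂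

end Summit.RiemannHypothesis.RiemannHypothesis.Theorems.SignConeConeMagnification

end
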